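import Literature.Geometry.Lorentzian.OpensChartGeodesicODE
import Literature.Geometry.Lorentzian.IsometricImmersionExp
import Literature.Geometry.Lorentzian.ImmersedChartRicci
import Literature.Geometry.Lorentzian.ChartMetricCoord
import Literature.Geometry.Lorentzian.GeodesicMaximal
import Literature.Geometry.Lorentzian.GeodesicExtension
import Literature.Geometry.Lorentzian.SpacetimeMetricInCoordsCalculus
import Literature.Geometry.Lorentzian.CoordScalarCurvatureEvolution
import HarnessLib

/-!
# Crux `SettledCapture` (stmt-FinalStateConjecture-17328), line `null-concave-crush`, stub
# `stub_crushTransport` — part 3/5: geodesic lifts along an immersed, injective chart of a spacetime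

Route `BartnikGapSettling`; helper module (`--supports stmt-FinalStateConjecture-17328`) of the
registered stub `stub_crushTransport`. Manifold plumbing over the tree's geodesic and chart calculus:
for a spacetime `𝓢` and `ψ : E4 → 𝓢` of class `C^∞` on an open `A ⊆ E4` with injective differential,
and the pullback metric `g' = ψ^* g` on the open submanifold `A` (`PseudoRiemannianMetric.comap` along
`ψ ∘ Subtype.val`, representative `𝓢.metricInCoords ψ`: `crushTransportLiftMetric_val`,
`crushTransportLiftMetric_hasLeviCivita`):
* `crushTransport_lift_isGeodesicOn` — if `ψ` is injective on `A`, every geodesic `γ` of `𝓢` on an open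
  interval lying in `ψ(A)` lifts (set-theoretically) to a geodesic `β` of `ψ^* g` with `dψ(β') = γ'`:
  local isometries map geodesics to geodesics (`isGeodesicOn_comp_of_comap`, O'Neill 1983, Ch. 3,
  Prop. 3.59, pp. 90–91) and geodesics are unique (Lemma 3.22, `IsGeodesicOn.eqOn_of_velocity_eq_holds`);
* `crushTransport_lift_hasDerivAt` — for a metric `g'` on `A` with representative `𝓢.metricInCoords ψ`
  and `f` of class `C²` near `A`, along a geodesic `β` of `g'`: `(f ∘ β)' = df(β')` and
  `(f ∘ β)'' = hessAt (𝓢.metricInCoords ψ) f (β', β')` (coordinate geodesic equations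
  `β'' = −Γ(β', β')`, `OpensChart.hasDerivAt_of_isGeodesicOn`, Cor. 3.21 and Lemma 3.49), and `f ∘ β`
  is `C²` (`OpensChart.contDiffAt_of_isGeodesicOn`, Lemma 3.22).

## References
* B. O'Neill, *Semi-Riemannian geometry with applications to relativity*, Academic Press 1983, Ch. 3,
  Cor. 21, Lemma 22, Lemma 3.49, Prop. 3.59 and pp. 90–91; Ch. 5, Lemma 5.26, Lemma 5.29. [ONeill1983]
* M. Dafermos, I. Rodnianski, arXiv:0811.0354, §5.1 (ingoing Kerr–Schild coordinates). [arXiv08110354]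
* M. Dafermos, J. Luk, arXiv:1710.01722 (the Kerr interior: red-shift and no-shift regions). [DafermosLuk2017]
-/

noncomputable section

-- instance search through the nested operator types `E4 →L[ℝ] E4 →L[ℝ] E4 →L[ℝ] ℝ`
set_option maxSynthPendingDepth 3

-- D-0017: single-problem summit, `Summit.<S>.<S>.…` by design (cf. lakefile `weak.linter.dupNamespace`).
set_option linter.dupNamespace false

namespace Summit.FinalStateConjecture.FinalStateConjecture.Theorems.BartnikGapSettling.SettledCapture

open Set Filter Function TopologicalSpace
open scoped Manifold ContDiff Topology ENNReal
open Literature.Geometry.Lorentzian Literature.Geometry.Lorentzian.MetricCoord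

/-! ### Part II. Geodesic lifts along an immersed, injective chart of a spacetime -/

section Lift

variable (𝓢 : Spacetime.{0} 4) {A : Opens E4} {ψ : E4 → 𝓢.carrier}
  (hψ : ContMDiffOn 𝓘(ℝ, E4) (𝓡 4) ((⊤ : ℕ∞) : WithTop ℕ∞) ψ A)
  (hψ' : ∀ z ∈ A, Injective (mfderiv 𝓘(ℝ, E4) (𝓡 4) ψ z))

/-- The representative of the pullback metric `ψ^* g` on the open submanifold `A ⊆ E4` along the immersed
chart `ψ` (`PseudoRiemannianMetric.comap` along `ψ ∘ Subtype.val`) is the field of components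
`𝓢.metricInCoords ψ`. [cite: ONeill1983, Ch. 3, Def. 3.9] -/
theorem crushTransportLiftMetric_val (y : A) :
    (𝓢.metric.toPseudoRiemannianMetric.comap PseudoRiemannianMetric.contMDiff_pullbackBilin_holds
      (ψ ∘ (Subtype.val : A → E4)) (contMDiff_immersedChart_comp_val hψ)
      (injective_mfderiv_immersedChart_comp_val hψ hψ') rfl).val y =
      𝓢.metricInCoords ψ y :=
  val_comap_immersedChart _ hψ hψ' rfl y

/-- The pullback metric `ψ^* g` on the open submanifold `A` has its Levi-Civita connection.
[cite: ONeill1983, Ch. 3, Thm. 3.11] -/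
theorem crushTransportLiftMetric_hasLeviCivita :
    (𝓢.metric.toPseudoRiemannianMetric.comap PseudoRiemannianMetric.contMDiff_pullbackBilin_holds
      (ψ ∘ (Subtype.val : A → E4)) (contMDiff_immersedChart_comp_val hψ)
      (injective_mfderiv_immersedChart_comp_val hψ hψ') rfl).HasLeviCivita :=
  haveI : Fact ((1 : ℕ∞ω) ≤ ((⊤ : ℕ∞) : WithTop ℕ∞)) := ⟨by exact_mod_cast le_top⟩
  PseudoRiemannianMetric.hasLeviCivita _

/-- **Lifting a geodesic along an injective immersed chart.** Let `ψ : E4 → 𝓢` be `C^∞` on the open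
set `A` with injective differential there and injective on `A`, let `γ` be a geodesic of `𝓢` on an open
interval `W` lying in `ψ(A)`, and let `β : ℝ → A` be its set-theoretic lift (`ψ ∘ β = γ` on `W`). Then
`β` is a geodesic of the pullback metric `g' = ψ^* g` on `W`, and `dψ(β') = γ'` on `W`. At `t ∈ W` the
maximal `ψ^* g`-geodesic `ζ` with data `(β t, dψ⁻¹ γ'(t))` is mapped by the local isometry `ψ` to a
geodesic with the data of `γ(· + t)` (O'Neill 1983, Ch. 3, Prop. 3.59 and pp. 90–91), hence agrees with
it near `0` (uniqueness, Lemma 3.22), so `ζ = β(· + t)` near `0` by injectivity.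
[cite: ONeillSemiRiemannian1983, Ch. 3, pp. 90–91] -/
theorem crushTransport_lift_isGeodesicOn [𝓢.metric.HasLeviCivita]
    (g' : PseudoRiemannianMetric 𝓘(ℝ, E4) ((⊤ : ℕ∞) : WithTop ℕ∞) E4 (TangentSpace 𝓘(ℝ, E4) : A → Type _))
    [hL : g'.HasLeviCivita]
    (hg' : g' = (𝓢.metric.toPseudoRiemannianMetric.comap PseudoRiemannianMetric.contMDiff_pullbackBilin_holds
        (ψ ∘ (Subtype.val : A → E4)) (contMDiff_immersedChart_comp_val hψ)
        (injective_mfderiv_immersedChart_comp_val hψ hψ') rfl))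
    (hinj : InjOn ψ A) {γ : ℝ → 𝓢.carrier} {W : Set ℝ} (hW : IsOpen W) (hWc : W.OrdConnected)
    (hγ : IsGeodesicOn 𝓢.metric.leviCivita γ W) {β : ℝ → A} (hβγ : ∀ t ∈ W, ψ (β t) = γ t) :
    IsGeodesicOn g'.leviCivita β W ∧
      ∀ t ∈ W, mfderiv 𝓘(ℝ, E4) (𝓡 4) ψ (β t : E4) (velocity 𝓘(ℝ, E4) β t) = velocity (𝓡 4) γ t := by
  subst hg'
  set g' := (𝓢.metric.toPseudoRiemannianMetric.comap PseudoRiemannianMetric.contMDiff_pullbackBilin_holds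
    (ψ ∘ (Subtype.val : A → E4)) (contMDiff_immersedChart_comp_val hψ)
    (injective_mfderiv_immersedChart_comp_val hψ hψ') rfl) with hg'
  -- regularity instances for existence and uniqueness of geodesics
  haveI : Fact ((1 : ℕ∞ω) ≤ ((⊤ : ℕ∞) : WithTop ℕ∞)) := ⟨by exact_mod_cast le_top⟩
  haveI : CovariantDerivative.ContMDiffCovariantDerivative g'.leviCivita 1 :=
    ⟨g'.isLocallyContMDiff_leviCivita_holds 1
      (by rw [show ((1 : ℕ∞) : ℕ∞ω) + 1 = 2 by norm_num]; exact WithTop.coe_le_coe.2 le_top)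
      univ isOpen_univ⟩
  haveI : CovariantDerivative.ContMDiffCovariantDerivative 𝓢.metric.leviCivita 1 :=
    ⟨𝓢.metric.toPseudoRiemannianMetric.isLocallyContMDiff_leviCivita_holds 1
      (by rw [show ((1 : ℕ∞) : ℕ∞ω) + 1 = 2 by norm_num]; exact WithTop.coe_le_coe.2 le_top)
      univ isOpen_univ⟩
  have hχs : ContMDiff 𝓘(ℝ, E4) (𝓡 4) (((⊤ : ℕ∞) : WithTop ℕ∞) + 1) (ψ ∘ (Subtype.val : A → E4)) :=
    contMDiff_immersedChart_comp_val hψ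
  have hχ' : ∀ u : A, Injective (mfderiv 𝓘(ℝ, E4) (𝓡 4) (ψ ∘ (Subtype.val : A → E4)) u) :=
    injective_mfderiv_immersedChart_comp_val hψ hψ'
  -- the local statement at each parameter
  have main : ∀ t ∈ W, ∃ J : Set ℝ, IsOpen J ∧ t ∈ J ∧ IsGeodesicOn g'.leviCivita β J ∧
      mfderiv 𝓘(ℝ, E4) (𝓡 4) ψ (β t : E4) (velocity 𝓘(ℝ, E4) β t) = velocity (𝓡 4) γ t := by
    intro t ht
    have hDinv : (mfderiv 𝓘(ℝ, E4) (𝓡 4) (ψ ∘ (Subtype.val : A → E4)) (β t)).IsInvertible :=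
      PseudoRiemannianMetric.isInvertible_mfderiv_of_injective (I := 𝓡 4) (I' := 𝓘(ℝ, E4)) rfl
        (hχ' (β t))
    set v : E4 := (mfderiv 𝓘(ℝ, E4) (𝓡 4) (ψ ∘ (Subtype.val : A → E4)) (β t)).inverse
      (velocity (𝓡 4) γ t) with hvdef
    have hv : mfderiv 𝓘(ℝ, E4) (𝓡 4) (ψ ∘ (Subtype.val : A → E4)) (β t) v = velocity (𝓡 4) γ t :=
      hDinv.self_apply_inverse _
    obtain ⟨ζ, S, hζmax, h0S, hζ0, hζv, -⟩ := exists_isMaximalGeodesicOn (cov := g'.leviCivita) (β t) v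
    obtain ⟨hχζ, hvel⟩ := PseudoRiemannianMetric.isGeodesicOn_comp_of_comap
      𝓢.metric.toPseudoRiemannianMetric PseudoRiemannianMetric.contMDiff_pullbackBilin_holds hχs hχ' rfl
      hζmax.isOpen hζmax.isGeodesicOn
    -- the translate `u ↦ γ (u + t)` of `γ`
    have hγ₂ : IsGeodesicOn 𝓢.metric.leviCivita (fun u => γ (u - -t)) ((fun u => u - -t) ⁻¹' W) :=
      hγ.comp_sub_const (-t)
    set J : Set ℝ := S ∩ (fun u => u - -t) ⁻¹' W with hJdef
    have hJo : IsOpen J := hζmax.isOpen.inter (hW.preimage (continuous_id.sub continuous_const))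
    have hJc : J.OrdConnected := by
      refine hζmax.2.1.inter ⟨fun a₁ ha₁ a₂ ha₂ u hu => ?_⟩
      exact hWc.out ha₁ ha₂ ⟨by linarith [hu.1], by linarith [hu.2]⟩
    have h0W : (0 : ℝ) - -t ∈ W := by rw [zero_sub, neg_neg]; exact ht
    have h0J : (0 : ℝ) ∈ J := ⟨h0S, h0W⟩
    have hpos : (ψ ∘ (Subtype.val : A → E4) ∘ ζ) 0 = (fun u => γ (u - -t)) 0 := by
      show ψ (ζ 0 : E4) = γ (0 - -t)
      rw [hζ0, zero_sub, neg_neg]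
      exact hβγ t ht
    have hvel0 : velocity (𝓡 4) (ψ ∘ (Subtype.val : A → E4) ∘ ζ) 0 =
        velocity (𝓡 4) (fun u => γ (u - -t)) 0 := by
      rw [show (ψ ∘ (Subtype.val : A → E4) ∘ ζ) = (ψ ∘ (Subtype.val : A → E4)) ∘ ζ from rfl,
        hvel 0 h0S, hζv, hζ0, hv, velocity_comp_sub_const, zero_sub, neg_neg]
    have heq : EqOn ((ψ ∘ (Subtype.val : A → E4)) ∘ ζ) (fun u => γ (u - -t)) J :=
      IsGeodesicOn.eqOn_of_velocity_eq_holds hJo hJc (hχζ.mono inter_subset_left)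
        (hγ₂.mono inter_subset_right) h0J hpos hvel0
    -- `ζ` is the translate of `β` on `J`, by injectivity of `ψ` on `A`
    have hζβ : EqOn ζ (fun u => β (u - -t)) J := by
      intro u hu
      apply Subtype.ext
      apply hinj (ζ u).2 (β (u - -t)).2
      have h1 := heq hu
      simp only [comp_apply] at h1
      rw [h1]
      exact (hβγ _ hu.2).symm
    have hβJ : IsGeodesicOn g'.leviCivita (fun u => β (u - -t)) J :=
      IsGeodesicOn.congr_holds (hζmax.isGeodesicOn.mono inter_subset_left) hJo hζβ
    have hβJ' := hβJ.comp_sub_const t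
    have hfun : (fun s : ℝ => β (s - t - -t)) = β := funext fun s => by
      congr 1
      ring
    rw [hfun] at hβJ'
    refine ⟨(fun s : ℝ => s - t) ⁻¹' J, hJo.preimage (continuous_id.sub continuous_const), ?_, hβJ', ?_⟩
    · show t - t ∈ J
      rw [sub_self]
      exact h0J
    · have hev : (fun u => β (u - -t)) =ᶠ[𝓝 0] ζ :=
        (Filter.eventuallyEq_of_mem (hJo.mem_nhds h0J) hζβ).symm
      have hv' : velocity 𝓘(ℝ, E4) ζ 0 = velocity 𝓘(ℝ, E4) β t := by
        rw [← velocity_congr_of_eventuallyEq hev, velocity_comp_sub_const, zero_sub, neg_neg]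
      rw [← mfderiv_immersedChart_comp_val_apply hψ (β t) (velocity 𝓘(ℝ, E4) β t), ← hv', hζv]
      exact hv
  refine ⟨⟨fun t ht => ?_, fun t ht => ?_⟩, fun t ht => ?_⟩
  · obtain ⟨J, -, htJ, hJ, -⟩ := main t ht
    exact hJ.1 t htJ
  · obtain ⟨J, -, htJ, hJ, -⟩ := main t ht
    exact hJ.2 t htJ
  · obtain ⟨J, -, -, -, h⟩ := main t ht
    exact h


/-- **A `C²` function along a geodesic of the pullback metric** (O'Neill 1983, Ch. 3, Cor. 21 and
Lemma 3.49): for a geodesic `β` of `ψ^* g` on the open parameter set `W` and `f` of class `C²` near `A`,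
`h = f ∘ β` has `h' = df(β')` and `h'' = Hess f(β', β')` on `W` — the coordinate Hessian `hessAt` of the
components `𝓢.metricInCoords ψ`, since `β'' = −Γ(β', β')` — and `h` is `C²` at every point of `W`
(geodesics are `C^∞`, Lemma 3.22). [cite: ONeill1983, Ch. 3, Cor. 21 and Lemma 3.49] -/
theorem crushTransport_lift_hasDerivAt
    (g' : PseudoRiemannianMetric 𝓘(ℝ, E4) ((⊤ : ℕ∞) : WithTop ℕ∞) E4 (TangentSpace 𝓘(ℝ, E4) : A → Type _))
    [hL : g'.HasLeviCivita] (hG : ∀ y : A, g'.val y = 𝓢.metricInCoords ψ y) {β : ℝ → A} {W : Set ℝ}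
    (hW : IsOpen W) (hβ : IsGeodesicOn g'.leviCivita β W) {f : E4 → ℝ} {O : Set E4}
    (hO : IsOpen O) (hAO : (A : Set E4) ⊆ O) (hf : ContDiffOn ℝ 2 f O) :
    (∀ t ∈ W, HasDerivAt (fun s => f (β s)) (fderiv ℝ f (β t) (velocity 𝓘(ℝ, E4) β t)) t) ∧
    (∀ t ∈ W, HasDerivAt (fun s => fderiv ℝ f (β s) (velocity 𝓘(ℝ, E4) β s))
      (hessAt (𝓢.metricInCoords ψ) f (β t) (velocity 𝓘(ℝ, E4) β t) (velocity 𝓘(ℝ, E4) β t)) t) ∧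
    (∀ t ∈ W, ContDiffAt ℝ 2 (fun s => f (β s)) t) := by
  set G := 𝓢.metricInCoords ψ with hGdef
  have hGm : IsMetricOn G (A : Set E4) := OpensChart.isMetricOn_repr hG
  have hGd : ∀ y : A, DifferentiableAt ℝ G y := fun y => hGm.differentiableAt y.2
  have hf2 : ∀ t : ℝ, ContDiffAt ℝ 2 f (β t) := fun t =>
    hf.contDiffAt (hO.mem_nhds (hAO (β t).2))
  -- the geodesic equations in the chart
  have hode : ∀ t ∈ W, HasDerivAt (fun s => (β s : E4)) (velocity 𝓘(ℝ, E4) β t) t ∧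
      HasDerivAt (fun s => velocity 𝓘(ℝ, E4) β s)
        (-chrAt G (β t) (velocity 𝓘(ℝ, E4) β t) (velocity 𝓘(ℝ, E4) β t)) t := by
    intro t ht
    obtain ⟨h1, h2⟩ := OpensChart.hasDerivAt_of_isGeodesicOn hG hGd hβ ht
    rw [OpensChart.christoffel_eq_chrAt hG] at h2
    exact ⟨h1, h2⟩
  refine ⟨fun t ht => ?_, fun t ht => ?_, fun t ht => ?_⟩
  · exact ((hf2 t).differentiableAt (by norm_num)).hasFDerivAt.comp_hasDerivAt t (hode t ht).1
  · obtain ⟨h1, h2⟩ := hode t ht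
    have hdf : HasFDerivAt (fderiv ℝ f) (fderiv ℝ (fderiv ℝ f) (β t)) (β t) :=
      (((hf2 t).fderiv_right (m := 1) (by norm_num)).differentiableAt one_ne_zero).hasFDerivAt
    have hc : HasDerivAt (fun s => fderiv ℝ f (β s)) (fderiv ℝ (fderiv ℝ f) (β t) (velocity 𝓘(ℝ, E4) β t)) t :=
      hdf.comp_hasDerivAt t h1
    refine (hc.clm_apply h2).congr_deriv ?_
    rw [hessAt_apply, map_neg, ← sub_eq_add_neg]
  · -- geodesics are smooth: the Christoffel data `(y, v) ↦ Γ_y(v, v)` are `C^∞` on `A × E4`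
    have hΦ : ContDiffOn ℝ ((⊤ : ℕ∞) : WithTop ℕ∞) (fun q : E4 × E4 => chrAt G q.1 q.2 q.2)
        ((A : Set E4) ×ˢ univ) := by
      have h1 : ContDiffOn ℝ ((⊤ : ℕ∞) : WithTop ℕ∞) (fun q : E4 × E4 => chrAt G q.1)
          ((A : Set E4) ×ˢ univ) :=
        hGm.contDiffOn_chrAt.comp contDiffOn_fst fun q hq => hq.1
      exact (h1.clm_apply contDiffOn_snd).clm_apply contDiffOn_snd
    have hΦΓ : ∀ (y : A) (v : E4), chrAt G y v v = OpensChart.christoffel g' G y v v := fun y v => by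
      rw [OpensChart.christoffel_eq_chrAt hG]
    have hβs := (OpensChart.contDiffAt_of_isGeodesicOn hG hGd (Φ := fun y v => chrAt G y v v) hΦ hΦΓ
      hW hβ ht).1
    exact (hf2 t).comp t (hβs.of_le (WithTop.coe_le_coe.mpr le_top))

/-- **Registered sub-goal `stub_crushTransportLift`** (helper of stub `stub_crushTransport`, line
`null-concave-crush`): geodesics of a spacetime lying in the image of an injective immersed chart lift to
geodesics of the pullback metric, i.e. `crushTransport_lift_isGeodesicOn` in registered one-line form.
[cite: ONeillSemiRiemannian1983, Ch. 3, pp. 90–91] -/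
theorem stub_crushTransportLift : ∀ (𝓢 : Spacetime.{0} 4) (A : TopologicalSpace.Opens E4) (ψ : E4 → 𝓢.carrier) (hψ : ContMDiffOn 𝓘(ℝ, E4) (𝓡 4) ((⊤ : ℕ∞) : WithTop ℕ∞) ψ A) (hψ' : ∀ z ∈ A, Function.Injective (mfderiv 𝓘(ℝ, E4) (𝓡 4) ψ z)), Set.InjOn ψ A → ∀ [𝓢.metric.HasLeviCivita] (γ : ℝ → 𝓢.carrier) (W : Set ℝ), IsOpen W → W.OrdConnected → IsGeodesicOn 𝓢.metric.leviCivita γ W → ∀ (β : ℝ → A), (∀ t ∈ W, ψ (β t) = γ t) → ∀ [(𝓢.metric.toPseudoRiemannianMetric.comap PseudoRiemannianMetric.contMDiff_pullbackBilin_holds (ψ ∘ (Subtype.val : A → E4)) (contMDiff_immersedChart_comp_val hψ) (injective_mfderiv_immersedChart_comp_val hψ hψ') rfl).HasLeviCivita], IsGeodesicOn (𝓢.metric.toPseudoRiemannianMetric.comap PseudoRiemannianMetric.contMDiff_pullbackBilin_holds (ψ ∘ (Subtype.val : A → E4)) (contMDiff_immersedChart_comp_val hψ) (injective_mfderiv_immersedChart_comp_val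 hψ hψ') rfl).leviCivita β W ∧ ∀ t ∈ W, mfderiv 𝓘(ℝ, E4) (𝓡 4) ψ (β t : E4) (velocity 𝓘(ℝ, E4) β t) = velocity (𝓡 4) γ t := by
  intro 𝓢 A ψ hψ hψ' hinj _ γ W hW hWc hγ β hβγ _
  exact crushTransport_lift_isGeodesicOn 𝓢 hψ hψ' _ rfl hinj hW hWc hγ hβγ

end Lift

end Summit.FinalStateConjecture.FinalStateConjecture.Theorems.BartnikGapSettling.SettledCapture

end
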